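import Summits.Ventures.HodgeRepro2.T7SupportDominantTermTail

/-!
# A sum with a dominant term is non-zero (support, seat p1)

The closing step of a «dominant term» argument, in the abstract: if a family of complex weights is
absolutely summable, its `x0`-term is non-zero and the other terms contribute at most half of it in norm,
then the sum is non-zero (`tsum_ne_zero_of_tail_le_half`). Combined with the tail bound of
`T7SupportDominantTermTail` (Gaussian–polynomial shapes, threshold `ρ N → ∞`) this gives
`exists_tsum_ne_zero`: for some level `N` the sum `∑' x, w N x` is non-zero, provided `a x0 ≠ 0` and
`b N x0 ≠ 0` for `N` large.

Pure analysis over an abstract index type; nothing here is about any geometric or automorphic object.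
Blind lane: Mathlib + the HodgeRepro2 prefix only; no sorry; axioms ⊆ {propext, Classical.choice, Quot.sound}.
-/

namespace Summit.Ventures.HodgeRepro2.T7SupportDominantTermNonzero

open Filter Topology T7SupportDominantTermTail

variable {Orb : Type} [DecidableEq Orb]

/-- **Dominant term ⇒ non-zero sum.** If `w` is absolutely summable, `w x0 ≠ 0`, and the terms other than
`x0` contribute at most half of `‖w x0‖`, then `∑' x, w x ≠ 0`. -/
theorem tsum_ne_zero_of_tail_le_half (x0 : Orb) (w : Orb → ℂ)
    (hs : Summable fun x => ‖w x‖) (hx0 : w x0 ≠ 0)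
    (htail : (∑' x, ‖(if x = x0 then 0 else w x)‖) ≤ (1 / 2 : ℝ) * ‖w x0‖) :
    ∑' x, w x ≠ 0 := by
  have hw : Summable w := hs.of_norm
  rw [hw.tsum_eq_add_tsum_ite x0]
  intro h
  have hsum_ite : Summable fun x => ‖(if x = x0 then 0 else w x)‖ := by
    refine Summable.of_nonneg_of_le (fun _ => norm_nonneg _) (fun x => ?_) hs
    split_ifs <;> simp
  have h1 : ‖w x0‖ = ‖∑' x, (if x = x0 then 0 else w x)‖ := by
    have : w x0 = -(∑' x, (if x = x0 then 0 else w x)) := eq_neg_of_add_eq_zero_left h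
    rw [this, norm_neg]
  have h2 : ‖∑' x, (if x = x0 then 0 else w x)‖ ≤ ∑' x, ‖(if x = x0 then 0 else w x)‖ :=
    norm_tsum_le_tsum_norm hsum_ite
  have hpos : 0 < ‖w x0‖ := norm_pos_iff.mpr hx0
  linarith

/-- **The dominant-term argument, assembled.** In the Gaussian–polynomial shapes of
`T7SupportDominantTermTail.tail_le_half_of_tendsto`, if moreover the weights are absolutely summable at
every level and `b N x0 ≠ 0` for `N` large, then some level has a non-zero sum. -/
theorem exists_tsum_ne_zero
    (x0 : Orb) (size : Orb → ℝ) (arith : ℕ → Orb → Prop) (a : Orb → ℂ) (b : ℕ → Orb → ℂ)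
    (w : ℕ → Orb → ℂ) (hw : ∀ N x, w N x = a x * b N x)
    (size_nonneg : ∀ x, 0 ≤ size x)
    (b_support : ∀ N x, b N x ≠ 0 → arith N x)
    (a_bound : ∃ C c d : ℝ, 0 < c ∧
      ∀ x, ‖a x‖ ≤ C * (1 + size x) ^ d * Real.exp (-c * size x))
    (ρ : ℕ → ℝ) (hρ : Tendsto ρ atTop atTop)
    (size_of_arith : ∀ N x, arith N x → x ≠ x0 → ρ N ≤ size x)
    (count_bound : ∃ C d : ℝ, ∀ N (R : ℝ), 0 ≤ R →
      ∃ s : Finset Orb, (∀ x, arith N x → size x ≤ R → x ∈ s) ∧ (s.card : ℝ) ≤ C * (1 + R) ^ d)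
    (b_bound : ∃ B d : ℝ, ∀ N x, arith N x → ‖b N x‖ ≤ B * (1 + size x) ^ d * ‖b N x0‖)
    (a_x0 : a x0 ≠ 0)
    (abs_summable : ∀ N, Summable fun x => ‖w N x‖)
    (b_x0 : ∃ N₀ : ℕ, ∀ N ≥ N₀, b N x0 ≠ 0) :
    ∃ N : ℕ, ∑' x, w N x ≠ 0 := by
  obtain ⟨N₁, hN₁⟩ := tail_le_half_of_tendsto x0 size arith a b w hw size_nonneg b_support a_bound
    ρ hρ size_of_arith count_bound b_bound a_x0
  obtain ⟨N₀, hN₀⟩ := b_x0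
  refine ⟨max N₀ N₁, ?_⟩
  have hx0 : w (max N₀ N₁) x0 ≠ 0 := by
    rw [hw]
    exact mul_ne_zero a_x0 (hN₀ _ (le_max_left _ _))
  exact tsum_ne_zero_of_tail_le_half x0 (w (max N₀ N₁)) (abs_summable _) hx0
    (hN₁ _ (le_max_right _ _))

end Summit.Ventures.HodgeRepro2.T7SupportDominantTermNonzero
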